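import Summits.Ventures.PercRepro.Night2ExcessLossM2

/-!
# PercRepro — the `(7, 5)` cell `(3, 1)` with spread basis members in the per-basis excess regime (night-2, gen 20)

`Night2ExcessCellsB` closes `(3, 1)` for `9 ≤ |G| ≤ 20` with the non-basis members missing `≥ 3` points at
`10 ≤ |G| ≤ 17`.  With the `m₂`-chord (basis members missing `≥ m₂` points) and NO hypothesis on the non-basis
members the target sum holds at `n = |G| − 1 = 9, 16` with `m₂ = 3` and at `n = 10, 14, 15` with `m₂ = 4`
(`n = 11, 12, 13` need `m₂ = 5`: g19's `localShadowHall_three_one_five_of_spread2`).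
**`localShadowHall_three_one_five_of_excess_m2`**: (LI_G) at the cell for `10 ≤ |G| ≤ 17` when the basis members
miss `≥ 3` (`|G| ∈ {10, 17}`), `≥ 4` (`|G| ∈ {11, 15, 16}`), `≥ 5` (`|G| ∈ {12, 13, 14}`) points.
-/

namespace PercRepro.Shadow

open Finset PerFlat ThmH

namespace DGenP

/-- The chord of `1/(m + 3)` over `3 ≤ m ≤ 5` (cell `(3, 1)`, `n = 9`, `m₂ = 3`). -/
theorem chord_three_one_9_m3 : ∀ m : ℕ, 3 ≤ m → m ≤ 5 →
    1 / ((m : ℚ) + ((3 : ℕ) : ℚ)) ≤ (11 / 48 : ℚ) - (1 / 48 : ℚ) * (m : ℚ) := by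
  intro m h1 h2
  interval_cases m <;> norm_num

/-- The `m₂ = 3` chord is nonnegative on `2 ≤ m ≤ 5`. -/
theorem chordpos_three_one_9_m3 : ∀ m : ℕ, 2 ≤ m → m ≤ 5 → 0 ≤ (11 / 48 : ℚ) - (1 / 48 : ℚ) * (m : ℚ) := by
  intro m h1 h2
  interval_cases m <;> norm_num

/-- `excessBound = 5/16` at `(3, 1)`, `n = 9`, `m₂ = 3`. -/
theorem excessBound_three_one_9_m3 : excessBound 5 3 5 1 9 (11 / 48 : ℚ) (1 / 48 : ℚ) = (5 / 16 : ℚ) := by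
  unfold excessBound capDG phiQ; norm_num

/-- The target sum of the cell `(3, 1)` at `n = 9` with `(m₂, m₁) = (3, 2)`: `A = 84`, `T = 46`. -/
theorem sum_three_one_9_m3_m2 : 1 ≤ DGenP.genSum 9 5 3 (cPrimeDGP 5 3 5 1 2)
    (excessBound 5 3 5 1 9 (11 / 48 : ℚ) (1 / 48 : ℚ) / ((5 : ℕ) : ℚ)) := by
  have hc : cPrimeDGP 5 3 5 1 2 = (1 / 120 : ℚ) := by unfold cPrimeDGP capDG reqDGP phiQ; norm_num
  have hA : DGen.Aρt 9 5 3 = 84 := by decide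
  have hT : DGen.Ttop 9 3 = 46 := by decide
  have hC : Nat.choose 9 5 = 126 := by decide
  rw [excessBound_three_one_9_m3, hc, DGenP.genSum_eq (by norm_num) (by norm_num) (by norm_num), hA, hT, hC]
  norm_num

/-- The chord of `1/(m + 3)` over `4 ≤ m ≤ 6` (cell `(3, 1)`, `n = 10`, `m₂ = 4`). -/
theorem chord_three_one_10_m4 : ∀ m : ℕ, 4 ≤ m → m ≤ 6 →
    1 / ((m : ℚ) + ((3 : ℕ) : ℚ)) ≤ (13 / 63 : ℚ) - (1 / 63 : ℚ) * (m : ℚ) := by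
  intro m h1 h2
  interval_cases m <;> norm_num

/-- The `m₂ = 4` chord is nonnegative on `2 ≤ m ≤ 6`. -/
theorem chordpos_three_one_10_m4 : ∀ m : ℕ, 2 ≤ m → m ≤ 6 → 0 ≤ (13 / 63 : ℚ) - (1 / 63 : ℚ) * (m : ℚ) := by
  intro m h1 h2
  interval_cases m <;> norm_num

/-- `excessBound = 47/216` at `(3, 1)`, `n = 10`, `m₂ = 4`. -/
theorem excessBound_three_one_10_m4 : excessBound 5 3 5 1 10 (13 / 63 : ℚ) (1 / 63 : ℚ) = (47 / 216 : ℚ) := by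
  unfold excessBound capDG phiQ; norm_num

/-- The target sum of the cell `(3, 1)` at `n = 10` with `(m₂, m₁) = (4, 2)`: `A = 330`, `T = 56`. -/
theorem sum_three_one_10_m4_m2 : 1 ≤ DGenP.genSum 10 5 3 (cPrimeDGP 5 3 5 1 2)
    (excessBound 5 3 5 1 10 (13 / 63 : ℚ) (1 / 63 : ℚ) / ((5 : ℕ) : ℚ)) := by
  have hc : cPrimeDGP 5 3 5 1 2 = (1 / 120 : ℚ) := by unfold cPrimeDGP capDG reqDGP phiQ; norm_num
  have hA : DGen.Aρt 10 5 3 = 330 := by decide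
  have hT : DGen.Ttop 10 3 = 56 := by decide
  have hC : Nat.choose 10 5 = 252 := by decide
  rw [excessBound_three_one_10_m4, hc, DGenP.genSum_eq (by norm_num) (by norm_num) (by norm_num), hA, hT, hC]
  norm_num

/-- The chord of `1/(m + 3)` over `4 ≤ m ≤ 10` (cell `(3, 1)`, `n = 14`, `m₂ = 4`). -/
theorem chord_three_one_14_m4 : ∀ m : ℕ, 4 ≤ m → m ≤ 10 →
    1 / ((m : ℚ) + ((3 : ℕ) : ℚ)) ≤ (17 / 91 : ℚ) - (1 / 91 : ℚ) * (m : ℚ) := by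
  intro m h1 h2
  interval_cases m <;> norm_num

/-- The `m₂ = 4` chord is nonnegative on `2 ≤ m ≤ 10`. -/
theorem chordpos_three_one_14_m4 : ∀ m : ℕ, 2 ≤ m → m ≤ 10 → 0 ≤ (17 / 91 : ℚ) - (1 / 91 : ℚ) * (m : ℚ) := by
  intro m h1 h2
  interval_cases m <;> norm_num

/-- `excessBound = 9/104` at `(3, 1)`, `n = 14`, `m₂ = 4`. -/
theorem excessBound_three_one_14_m4 : excessBound 5 3 5 1 14 (17 / 91 : ℚ) (1 / 91 : ℚ) = (9 / 104 : ℚ) := by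
  unfold excessBound capDG phiQ; norm_num

/-- The target sum of the cell `(3, 1)` at `n = 14` with `(m₂, m₁) = (4, 2)`: `A = 12805`, `T = 106`. -/
theorem sum_three_one_14_m4_m2 : 1 ≤ DGenP.genSum 14 5 3 (cPrimeDGP 5 3 5 1 2)
    (excessBound 5 3 5 1 14 (17 / 91 : ℚ) (1 / 91 : ℚ) / ((5 : ℕ) : ℚ)) := by
  have hc : cPrimeDGP 5 3 5 1 2 = (1 / 120 : ℚ) := by unfold cPrimeDGP capDG reqDGP phiQ; norm_num
  have hA : DGen.Aρt 14 5 3 = 12805 := by decide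
  have hT : DGen.Ttop 14 3 = 106 := by decide
  have hC : Nat.choose 14 5 = 2002 := by decide
  rw [excessBound_three_one_14_m4, hc, DGenP.genSum_eq (by norm_num) (by norm_num) (by norm_num), hA, hT, hC]
  norm_num

/-- The chord of `1/(m + 3)` over `4 ≤ m ≤ 11` (cell `(3, 1)`, `n = 15`, `m₂ = 4`). -/
theorem chord_three_one_15_m4 : ∀ m : ℕ, 4 ≤ m → m ≤ 11 →
    1 / ((m : ℚ) + ((3 : ℕ) : ℚ)) ≤ (9 / 49 : ℚ) - (1 / 98 : ℚ) * (m : ℚ) := by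
  intro m h1 h2
  interval_cases m <;> norm_num

/-- The `m₂ = 4` chord is nonnegative on `2 ≤ m ≤ 11`. -/
theorem chordpos_three_one_15_m4 : ∀ m : ℕ, 2 ≤ m → m ≤ 11 → 0 ≤ (9 / 49 : ℚ) - (1 / 98 : ℚ) * (m : ℚ) := by
  intro m h1 h2
  interval_cases m <;> norm_num

/-- `excessBound = 11/168` at `(3, 1)`, `n = 15`, `m₂ = 4`. -/
theorem excessBound_three_one_15_m4 : excessBound 5 3 5 1 15 (9 / 49 : ℚ) (1 / 98 : ℚ) = (11 / 168 : ℚ) := by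
  unfold excessBound capDG phiQ; norm_num

/-- The target sum of the cell `(3, 1)` at `n = 15` with `(m₂, m₁) = (4, 2)`: `A = 27703`, `T = 121`. -/
theorem sum_three_one_15_m4_m2 : 1 ≤ DGenP.genSum 15 5 3 (cPrimeDGP 5 3 5 1 2)
    (excessBound 5 3 5 1 15 (9 / 49 : ℚ) (1 / 98 : ℚ) / ((5 : ℕ) : ℚ)) := by
  have hc : cPrimeDGP 5 3 5 1 2 = (1 / 120 : ℚ) := by unfold cPrimeDGP capDG reqDGP phiQ; norm_num
  have hA : DGen.Aρt 15 5 3 = 27703 := by decide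
  have hT : DGen.Ttop 15 3 = 121 := by decide
  have hC : Nat.choose 15 5 = 3003 := by decide
  rw [excessBound_three_one_15_m4, hc, DGenP.genSum_eq (by norm_num) (by norm_num) (by norm_num), hA, hT, hC]
  norm_num

/-- The chord of `1/(m + 3)` over `3 ≤ m ≤ 12` (cell `(3, 1)`, `n = 16`, `m₂ = 3`). -/
theorem chord_three_one_16_m3 : ∀ m : ℕ, 3 ≤ m → m ≤ 12 →
    1 / ((m : ℚ) + ((3 : ℕ) : ℚ)) ≤ (1 / 5 : ℚ) - (1 / 90 : ℚ) * (m : ℚ) := by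
  intro m h1 h2
  interval_cases m <;> norm_num

/-- The `m₂ = 3` chord is nonnegative on `2 ≤ m ≤ 12`. -/
theorem chordpos_three_one_16_m3 : ∀ m : ℕ, 2 ≤ m → m ≤ 12 → 0 ≤ (1 / 5 : ℚ) - (1 / 90 : ℚ) * (m : ℚ) := by
  intro m h1 h2
  interval_cases m <;> norm_num

/-- `excessBound = 13/120` at `(3, 1)`, `n = 16`, `m₂ = 3`. -/
theorem excessBound_three_one_16_m3 : excessBound 5 3 5 1 16 (1 / 5 : ℚ) (1 / 90 : ℚ) = (13 / 120 : ℚ) := by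
  unfold excessBound capDG phiQ; norm_num

/-- The target sum of the cell `(3, 1)` at `n = 16` with `(m₂, m₁) = (3, 2)`: `A = 58514`, `T = 137`. -/
theorem sum_three_one_16_m3_m2 : 1 ≤ DGenP.genSum 16 5 3 (cPrimeDGP 5 3 5 1 2)
    (excessBound 5 3 5 1 16 (1 / 5 : ℚ) (1 / 90 : ℚ) / ((5 : ℕ) : ℚ)) := by
  have hc : cPrimeDGP 5 3 5 1 2 = (1 / 120 : ℚ) := by unfold cPrimeDGP capDG reqDGP phiQ; norm_num
  have hA : DGen.Aρt 16 5 3 = 58514 := by decide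
  have hT : DGen.Ttop 16 3 = 137 := by decide
  have hC : Nat.choose 16 5 = 4368 := by decide
  rw [excessBound_three_one_16_m3, hc, DGenP.genSum_eq (by norm_num) (by norm_num) (by norm_num), hA, hT, hC]
  norm_num

end DGenP

variable {α : Type*} [DecidableEq α] {M : Matroid α} [M.Finite]

open DGenP in
open scoped Classical in
/-- **THE `(7, 5)` CELL `(3, 1)` WITH SPREAD BASIS MEMBERS**, `10 ≤ |G| ≤ 17`: the hyperplane-basis members miss
`≥ 3` points at `|G| ∈ {10, 17}`, `≥ 4` at `|G| ∈ {11, 15, 16}`, `≥ 5` at `|G| ∈ {12, 13, 14}`. -/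
theorem localShadowHall_three_one_five_of_excess_m2 {G : Finset α} (hG : G ∈ flatsQ M (5 + 1))
    (hd : (gr M \ G).card = 3) (hk : kColoops M G = 1)
    (hs : ∀ e ∈ gr M, ∀ f ∈ gr M, e ≠ f → rkN M {e, f} = 2) (hl : ∀ e ∈ gr M, M.Indep {e})
    (hn1 : 10 ≤ G.card) (hn2 : G.card ≤ 17)
    (hm3 : G.card = 10 ∨ G.card = 17 →
      ∀ B ∈ thinMembers M 5 G, (B \ coloops M G).card + 1 = 5 → 3 ≤ (G \ clF M B).card)
    (hm4 : G.card = 11 ∨ G.card = 15 ∨ G.card = 16 →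
      ∀ B ∈ thinMembers M 5 G, (B \ coloops M G).card + 1 = 5 → 4 ≤ (G \ clF M B).card)
    (hm5 : 12 ≤ G.card ∧ G.card ≤ 14 →
      ∀ B ∈ thinMembers M 5 G, (B \ coloops M G).card + 1 = 5 → 5 ≤ (G \ clF M B).card) :
    LocalShadowHall M 5 G := by
  have hk' : kColoops M G + 5 = 5 + 1 := by omega
  have hm1 : ∀ B ∈ thinMembers M 5 G, 5 ≤ (B \ coloops M G).card → 2 ≤ (G \ clF M B).card :=
    fun B hB _ => two_le_card_sdiff_of_not_lay0 hG (by omega) (mem_thinMembers.1 hB).1 (mem_thinMembers.1 hB).2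
  have hc2 : 0 ≤ cPrimeDGP 5 3 5 (kColoops M G) 2 := by rw [hk]; unfold cPrimeDGP capDG reqDGP phiQ; norm_num
  by_cases hmid : 12 ≤ G.card ∧ G.card ≤ 14
  · exact localShadowHall_three_one_five_of_spread2 hG hd hk hs hl hm1 (hm5 hmid)
  obtain ⟨n, hn⟩ : ∃ n, G.card - kColoops M G = n := ⟨_, rfl⟩
  have hn1' : 9 ≤ n := by omega
  have hn2' : n ≤ 16 := by omega
  have hn3' : ¬ (11 ≤ n ∧ n ≤ 13) := by omega
  interval_cases n
  · exact localShadowHall_excess_of_sum_m2 (d := 3) (ρ := 5) (m₁ := 2) (m₂ := 3) hG hd (by norm_num) hk'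
      (by norm_num) (by omega) hs hl hc2 hm1 (hm3 (by omega)) (a := (11 / 48 : ℚ)) (b := (1 / 48 : ℚ)) (by norm_num)
      (by rw [hn]; intro m h1 h2; exact chord_three_one_9_m3 m h1 (by omega))
      (by rw [hn]; intro m h1 h2; exact chordpos_three_one_9_m3 m h1 (by omega))
      (by rw [hn, hk, excessBound_three_one_9_m3]; norm_num) (by rw [hn, hk]; exact sum_three_one_9_m3_m2)
  · exact localShadowHall_excess_of_sum_m2 (d := 3) (ρ := 5) (m₁ := 2) (m₂ := 4) hG hd (by norm_num) hk'
      (by norm_num) (by omega) hs hl hc2 hm1 (hm4 (by omega)) (a := (13 / 63 : ℚ)) (b := (1 / 63 : ℚ)) (by norm_num)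
      (by rw [hn]; intro m h1 h2; exact chord_three_one_10_m4 m h1 (by omega))
      (by rw [hn]; intro m h1 h2; exact chordpos_three_one_10_m4 m h1 (by omega))
      (by rw [hn, hk, excessBound_three_one_10_m4]; norm_num) (by rw [hn, hk]; exact sum_three_one_10_m4_m2)
  · exact absurd ⟨by omega, by omega⟩ hn3'
  · exact absurd ⟨by omega, by omega⟩ hn3'
  · exact absurd ⟨by omega, by omega⟩ hn3'
  · exact localShadowHall_excess_of_sum_m2 (d := 3) (ρ := 5) (m₁ := 2) (m₂ := 4) hG hd (by norm_num) hk'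
      (by norm_num) (by omega) hs hl hc2 hm1 (hm4 (by omega)) (a := (17 / 91 : ℚ)) (b := (1 / 91 : ℚ)) (by norm_num)
      (by rw [hn]; intro m h1 h2; exact chord_three_one_14_m4 m h1 (by omega))
      (by rw [hn]; intro m h1 h2; exact chordpos_three_one_14_m4 m h1 (by omega))
      (by rw [hn, hk, excessBound_three_one_14_m4]; norm_num) (by rw [hn, hk]; exact sum_three_one_14_m4_m2)
  · exact localShadowHall_excess_of_sum_m2 (d := 3) (ρ := 5) (m₁ := 2) (m₂ := 4) hG hd (by norm_num) hk'
      (by norm_num) (by omega) hs hl hc2 hm1 (hm4 (by omega)) (a := (9 / 49 : ℚ)) (b := (1 / 98 : ℚ)) (by norm_num)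
      (by rw [hn]; intro m h1 h2; exact chord_three_one_15_m4 m h1 (by omega))
      (by rw [hn]; intro m h1 h2; exact chordpos_three_one_15_m4 m h1 (by omega))
      (by rw [hn, hk, excessBound_three_one_15_m4]; norm_num) (by rw [hn, hk]; exact sum_three_one_15_m4_m2)
  · exact localShadowHall_excess_of_sum_m2 (d := 3) (ρ := 5) (m₁ := 2) (m₂ := 3) hG hd (by norm_num) hk'
      (by norm_num) (by omega) hs hl hc2 hm1 (hm3 (by omega)) (a := (1 / 5 : ℚ)) (b := (1 / 90 : ℚ)) (by norm_num)
      (by rw [hn]; intro m h1 h2; exact chord_three_one_16_m3 m h1 (by omega))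
      (by rw [hn]; intro m h1 h2; exact chordpos_three_one_16_m3 m h1 (by omega))
      (by rw [hn, hk, excessBound_three_one_16_m3]; norm_num) (by rw [hn, hk]; exact sum_three_one_16_m3_m2)

end PercRepro.Shadow
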